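import Mathlib

/-!
# Stub `stub_scaleArith` for line `Sketch` of crux `FemtoCurvatureTwoPointC`

Pure `ℕ` bookkeeping of the clause scale `max 8 (min L (8 s))` (boxes are `≥ 8`, saturating at the
torus side `L`): the scale is `≥ 8`; it is `≤ L` once `L ≥ 8` and equals `8` when `L < 8`; and for
`a ≤ 4 b` one has `max 8 (min L (8 a)) ≤ 4 · max 8 (min L (8 b))`, since
`min L (8 a) ≤ min (4 L) (32 b) = 4 · min L (8 b)` and `8 ≤ 4 · 8`. Everything is linear
arithmetic over `ℕ` with `min` / `max`, closed by `omega`.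
-/

set_option autoImplicit false

namespace Summit.QuantumFields.YangMills.Theorems.FemtoCurvatureTwoPointC

/-- **Scale arithmetic.** The clause scale `max 8 (min L (8a))` is `≥ 8`, is `≤ L` once `L ≥ 8`,
equals `8` when `L < 8`, and moves by at most a factor `4` when `a` does (`a ≤ 4 b`). The hypotheses
`1 ≤ a`, `1 ≤ b`, `b ≤ 4 a` are not needed. [folklore] -/
theorem stub_scaleArith :
    ∀ (L a b : ℕ), 1 ≤ a → 1 ≤ b → a ≤ 4 * b → b ≤ 4 * a →
      8 ≤ max 8 (min L (8 * a)) ∧ max 8 (min L (8 * a)) ≤ 4 * max 8 (min L (8 * b)) ∧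
      (8 ≤ L → max 8 (min L (8 * a)) ≤ L) ∧ (L < 8 → max 8 (min L (8 * a)) = 8) := by
  intro L a b _ha _hb hab _hba
  omega

end Summit.QuantumFields.YangMills.Theorems.FemtoCurvatureTwoPointC
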